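import Mathlib
import Literature.NumberTheory.Transcendental.KZRulesAssociator
import Literature.NumberTheory.Transcendental.KZProductIdeal
import Literature.NumberTheory.Transcendental.KZGaussMultiplicationChain
import Literature.NumberTheory.Transcendental.KZBallVolume
import Summits.KontsevichZagierPeriods.KontsevichZagierPeriods.Theorems.HurwitzMicroSectorsNormalFormPrincipleAngCarriers
import Summits.KontsevichZagierPeriods.KontsevichZagierPeriods.Theorems.HyperbolicBlochOffTetraSectorKernelStubDiscClass
import Summits.KontsevichZagierPeriods.KontsevichZagierPeriods.Theorems.HyperbolicBlochOffTetraSectorKernelStubAffineOrbit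
import Summits.KontsevichZagierPeriods.KontsevichZagierPeriods.Theorems.TerasomaMultiplicationGammaHodgeFromRelatorsChains
import Summits.KontsevichZagierPeriods.KontsevichZagierPeriods.Theorems.TerasomaMultiplicationGammaHodgeSectorStubProducts
import Summits.KontsevichZagierPeriods.KontsevichZagierPeriods.Theorems.MzvKernelInKZ.Negative.ScalingDivision

/-!
# Lindemann's ring: its members — crux `OffTetraSectorKernel`, line `odd-hyperbolic-ladder` (v8, lead c6)

Companion of `…StubLindemannRing.lean` (`stub_lindemannRing`: on the subring `Subring.closure
      ({p : KZ.FormalPeriodRing | ∃ (a : ℝ) (ha : IsAlgebraic ℚ a),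
          p = KZ.toFormalPeriod (KZ.of (KZ.IntegralRep.unit.constMul a ha))} ∪
        {p : KZ.FormalPeriodRing | ∃ A : KZ.IntegralRep 1, A.domain = {t | t 0 ∈ Set.Ioo (0:ℝ) 1} ∧
          Set.EqOn A.integrand (fun t => 1 / (1 + t 0 ^ 2)) A.domain ∧ p = KZ.toFormalPeriod (KZ.of A)})` of the formal period
ring `P = FormalRep ⧸ relations` generated by the algebraic points `⟦[pt, a]⟧` and the arctangent
carriers `⟦[(0,1), 1/(1+t²)]⟧`, `evalP x = 0 → x = 0`). This file puts the ROUND BODIES into `Subring.closure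
      ({p : KZ.FormalPeriodRing | ∃ (a : ℝ) (ha : IsAlgebraic ℚ a),
          p = KZ.toFormalPeriod (KZ.of (KZ.IntegralRep.unit.constMul a ha))} ∪
        {p : KZ.FormalPeriodRing | ∃ A : KZ.IntegralRep 1, A.domain = {t | t 0 ∈ Set.Ioo (0:ℝ) 1} ∧
          Set.EqOn A.integrand (fun t => 1 / (1 + t 0 ^ 2)) A.domain ∧ p = KZ.toFormalPeriod (KZ.of A)})`, each
by explicit moves already landed in the tree:

* `lindemann_mem_pt`, `lindemann_mem_arc`, `lindemann_mem_prod` (generators; `Subring.closure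
      ({p : KZ.FormalPeriodRing | ∃ (a : ℝ) (ha : IsAlgebraic ℚ a),
          p = KZ.toFormalPeriod (KZ.of (KZ.IntegralRep.unit.constMul a ha))} ∪
        {p : KZ.FormalPeriodRing | ∃ A : KZ.IntegralRep 1, A.domain = {t | t 0 ∈ Set.Ioo (0:ℝ) 1} ∧
          Set.EqOn A.integrand (fun t => 1 / (1 + t 0 ^ 2)) A.domain ∧ p = KZ.toFormalPeriod (KZ.of A)})` is a subring and
  `⟦r × s⟧ = ⟦r⟧·⟦s⟧`, `KZ.toFormalPeriod_of_mul_of`);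
* `lindemann_torsionFree`, `lindemann_mem_of_natCast_mul` — `P` is torsion-free (integer division is a
  derived rule, `MzvKernelInKZ.Negative.mem_relations_of_nsmul_mem`) and `Subring.closure
      ({p : KZ.FormalPeriodRing | ∃ (a : ℝ) (ha : IsAlgebraic ℚ a),
          p = KZ.toFormalPeriod (KZ.of (KZ.IntegralRep.unit.constMul a ha))} ∪
        {p : KZ.FormalPeriodRing | ∃ A : KZ.IntegralRep 1, A.domain = {t | t 0 ∈ Set.Ioo (0:ℝ) 1} ∧
          Set.EqOn A.integrand (fun t => 1 / (1 + t 0 ^ 2)) A.domain ∧ p = KZ.toFormalPeriod (KZ.of A)}) ∋ ⟦[pt, 1/n]⟧`, so `Subring.closure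
      ({p : KZ.FormalPeriodRing | ∃ (a : ℝ) (ha : IsAlgebraic ℚ a),
          p = KZ.toFormalPeriod (KZ.of (KZ.IntegralRep.unit.constMul a ha))} ∪
        {p : KZ.FormalPeriodRing | ∃ A : KZ.IntegralRep 1, A.domain = {t | t 0 ∈ Set.Ioo (0:ℝ) 1} ∧
          Set.EqOn A.integrand (fun t => 1 / (1 + t 0 ^ 2)) A.domain ∧ p = KZ.toFormalPeriod (KZ.of A)})`
  is closed under the integer divisions the chains below need;
* `lindemann_mem_disc` — the disc `[D, c]` (c5's `stub_discClass`: `[D, c] ≡ [(0,1), 4c/(1+t²)]`,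
  Kontsevich–Zagier's first example) and `lindemann_mem_affineDisc` — every ellipse with real-algebraic
  affine data (c4's affine move `aff_orbit_of_sub_of_mem_changeOfVariablesRel`);
* `lindemann_mem_betaHalf` — Euler's `β(½,½) = [(0,1), (t(1−t))^{-1/2}]` (`= ⟦[disc, 1]⟧`,
  `KZ.BallPeeling.natCast_add_one_mul_toFormalPeriod_disc` at `e = 0`, Dirichlet's re-association being
  DISCHARGED by `TerasomaMultiplication.GammaHodgeFromRelators.betaClass_reassoc`);
* `lindemann_mem_ball` — the even-dimensional unit balls `B_{2k}` of every dimension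
  (`k!·⟦B_{2k}⟧ = ⟦β(½,½)⟧^k`, `KZ.BallPeeling.factorial_mul_toFormalPeriod_ball`, then division by `k!`).

References: M. Kontsevich, D. Zagier, *Periods* (2001), §1.1–1.2, §4.1; F. Lindemann, Math. Ann. 20
(1882); G. Andrews, R. Askey, R. Roy, *Special Functions* (1999), Thm 1.8.1.
-/

noncomputable section

open Set MeasureTheory
open Literature.NumberTheory.Transcendental

namespace Summit.KontsevichZagierPeriods.HyperbolicBloch.OffTetraSectorKernel

/-! ## Generators, products, torsion -/

/-- Algebraic points lie in Lindemann's ring. [cite: KontsevichZagier2001, §1.1] -/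
theorem lindemann_mem_pt {a : ℝ} (ha : IsAlgebraic ℚ a) :
    KZ.toFormalPeriod (KZ.of (KZ.IntegralRep.unit.constMul a ha)) ∈ Subring.closure
      ({p : KZ.FormalPeriodRing | ∃ (a : ℝ) (ha : IsAlgebraic ℚ a),
          p = KZ.toFormalPeriod (KZ.of (KZ.IntegralRep.unit.constMul a ha))} ∪
        {p : KZ.FormalPeriodRing | ∃ A : KZ.IntegralRep 1, A.domain = {t | t 0 ∈ Set.Ioo (0:ℝ) 1} ∧
          Set.EqOn A.integrand (fun t => 1 / (1 + t 0 ^ 2)) A.domain ∧ p = KZ.toFormalPeriod (KZ.of A)}) :=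
  Subring.subset_closure (Or.inl ⟨a, ha, rfl⟩)

/-- Arctangent carriers lie in Lindemann's ring. [cite: KontsevichZagier2001, §1.1] -/
theorem lindemann_mem_arc (A : KZ.IntegralRep 1) (hAd : A.domain = {t | t 0 ∈ Set.Ioo (0:ℝ) 1})
    (hAi : Set.EqOn A.integrand (fun t => 1 / (1 + t 0 ^ 2)) A.domain) :
    KZ.toFormalPeriod (KZ.of A) ∈ Subring.closure
      ({p : KZ.FormalPeriodRing | ∃ (a : ℝ) (ha : IsAlgebraic ℚ a),
          p = KZ.toFormalPeriod (KZ.of (KZ.IntegralRep.unit.constMul a ha))} ∪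
        {p : KZ.FormalPeriodRing | ∃ A : KZ.IntegralRep 1, A.domain = {t | t 0 ∈ Set.Ioo (0:ℝ) 1} ∧
          Set.EqOn A.integrand (fun t => 1 / (1 + t 0 ^ 2)) A.domain ∧ p = KZ.toFormalPeriod (KZ.of A)}) :=
  Subring.subset_closure (Or.inr ⟨A, hAd, hAi, rfl⟩)

/-- Products: `⟦r × s⟧ = ⟦r⟧·⟦s⟧` lies in the ring when both factors do (Fubini product of
representations, `KZ.toFormalPeriod_of_mul_of`). [cite: KontsevichZagier2001, §4.1] -/
theorem lindemann_mem_prod {n m : ℕ} {r : KZ.IntegralRep n} {s : KZ.IntegralRep m}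
    (hr : KZ.toFormalPeriod (KZ.of r) ∈ Subring.closure
      ({p : KZ.FormalPeriodRing | ∃ (a : ℝ) (ha : IsAlgebraic ℚ a),
          p = KZ.toFormalPeriod (KZ.of (KZ.IntegralRep.unit.constMul a ha))} ∪
        {p : KZ.FormalPeriodRing | ∃ A : KZ.IntegralRep 1, A.domain = {t | t 0 ∈ Set.Ioo (0:ℝ) 1} ∧
          Set.EqOn A.integrand (fun t => 1 / (1 + t 0 ^ 2)) A.domain ∧ p = KZ.toFormalPeriod (KZ.of A)})) (hs : KZ.toFormalPeriod (KZ.of s) ∈ Subring.closure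
      ({p : KZ.FormalPeriodRing | ∃ (a : ℝ) (ha : IsAlgebraic ℚ a),
          p = KZ.toFormalPeriod (KZ.of (KZ.IntegralRep.unit.constMul a ha))} ∪
        {p : KZ.FormalPeriodRing | ∃ A : KZ.IntegralRep 1, A.domain = {t | t 0 ∈ Set.Ioo (0:ℝ) 1} ∧
          Set.EqOn A.integrand (fun t => 1 / (1 + t 0 ^ 2)) A.domain ∧ p = KZ.toFormalPeriod (KZ.of A)})) :
    KZ.toFormalPeriod (KZ.of (r.prod s)) ∈ Subring.closure
      ({p : KZ.FormalPeriodRing | ∃ (a : ℝ) (ha : IsAlgebraic ℚ a),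
          p = KZ.toFormalPeriod (KZ.of (KZ.IntegralRep.unit.constMul a ha))} ∪
        {p : KZ.FormalPeriodRing | ∃ A : KZ.IntegralRep 1, A.domain = {t | t 0 ∈ Set.Ioo (0:ℝ) 1} ∧
          Set.EqOn A.integrand (fun t => 1 / (1 + t 0 ^ 2)) A.domain ∧ p = KZ.toFormalPeriod (KZ.of A)}) := by
  rw [← KZ.toFormalPeriod_of_mul_of]
  exact Subring.mul_mem _ hr hs

/-- **`P` is torsion-free**: `n · X = 0 → X = 0` for `0 < n` (integer division is a derived rule of the
calculus, `MzvKernelInKZ.Negative.mem_relations_of_nsmul_mem`). [cite: KontsevichZagier2001, §1.2] -/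
theorem lindemann_torsionFree {n : ℕ} (hn : 0 < n) {X : KZ.FormalPeriodRing}
    (h : (n : KZ.FormalPeriodRing) * X = 0) : X = 0 := by
  obtain ⟨c, rfl⟩ := KZ.toFormalPeriod_surjective X
  rw [← nsmul_eq_mul, ← map_nsmul, KZ.toFormalPeriod_eq_zero_iff] at h
  exact KZ.toFormalPeriod_eq_zero_iff.mpr
    (Summit.KontsevichZagierPeriods.MzvKernelInKZ.Negative.mem_relations_of_nsmul_mem hn h)

/-- **Integer division inside Lindemann's ring**: if `n · X ∈ Subring.closure
      ({p : KZ.FormalPeriodRing | ∃ (a : ℝ) (ha : IsAlgebraic ℚ a),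
          p = KZ.toFormalPeriod (KZ.of (KZ.IntegralRep.unit.constMul a ha))} ∪
        {p : KZ.FormalPeriodRing | ∃ A : KZ.IntegralRep 1, A.domain = {t | t 0 ∈ Set.Ioo (0:ℝ) 1} ∧
          Set.EqOn A.integrand (fun t => 1 / (1 + t 0 ^ 2)) A.domain ∧ p = KZ.toFormalPeriod (KZ.of A)})` (`0 < n`) then `X ∈ Subring.closure
      ({p : KZ.FormalPeriodRing | ∃ (a : ℝ) (ha : IsAlgebraic ℚ a),
          p = KZ.toFormalPeriod (KZ.of (KZ.IntegralRep.unit.constMul a ha))} ∪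
        {p : KZ.FormalPeriodRing | ∃ A : KZ.IntegralRep 1, A.domain = {t | t 0 ∈ Set.Ioo (0:ℝ) 1} ∧
          Set.EqOn A.integrand (fun t => 1 / (1 + t 0 ^ 2)) A.domain ∧ p = KZ.toFormalPeriod (KZ.of A)})`, because
`X = ⟦[pt, 1/n]⟧ · (n · X)` (`n · ⟦[pt, 1/n]⟧ = 1` and torsion-freeness). [cite: KontsevichZagier2001, §4.1] -/
theorem lindemann_mem_of_natCast_mul {n : ℕ} (hn : 0 < n) {X : KZ.FormalPeriodRing}
    (h : (n : KZ.FormalPeriodRing) * X ∈ Subring.closure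
      ({p : KZ.FormalPeriodRing | ∃ (a : ℝ) (ha : IsAlgebraic ℚ a),
          p = KZ.toFormalPeriod (KZ.of (KZ.IntegralRep.unit.constMul a ha))} ∪
        {p : KZ.FormalPeriodRing | ∃ A : KZ.IntegralRep 1, A.domain = {t | t 0 ∈ Set.Ioo (0:ℝ) 1} ∧
          Set.EqOn A.integrand (fun t => 1 / (1 + t 0 ^ 2)) A.domain ∧ p = KZ.toFormalPeriod (KZ.of A)})) : X ∈ Subring.closure
      ({p : KZ.FormalPeriodRing | ∃ (a : ℝ) (ha : IsAlgebraic ℚ a),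
          p = KZ.toFormalPeriod (KZ.of (KZ.IntegralRep.unit.constMul a ha))} ∪
        {p : KZ.FormalPeriodRing | ∃ A : KZ.IntegralRep 1, A.domain = {t | t 0 ∈ Set.Ioo (0:ℝ) 1} ∧
          Set.EqOn A.integrand (fun t => 1 / (1 + t 0 ^ 2)) A.domain ∧ p = KZ.toFormalPeriod (KZ.of A)}) := by
  obtain ⟨m, rfl⟩ : ∃ m, n = m + 1 := ⟨n - 1, by omega⟩
  have hinv : IsAlgebraic ℚ (((m : ℝ) + 1)⁻¹) := ((isAlgebraic_nat m).add isAlgebraic_one).inv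
  have hone := KZ.natCast_add_one_mul_toFormalPeriod_of_unit_constMul_inv m hinv
  set ι := KZ.toFormalPeriod (KZ.of (KZ.IntegralRep.unit.constMul (((m : ℝ) + 1)⁻¹) hinv)) with hι
  have hcast : ((m + 1 : ℕ) : KZ.FormalPeriodRing) = (m : KZ.FormalPeriodRing) + 1 := by push_cast; rfl
  have hX : X = ι * (((m + 1 : ℕ) : KZ.FormalPeriodRing) * X) := by
    rw [hcast, ← mul_assoc, mul_comm ι, hone, one_mul]
  rw [hX]
  exact Subring.mul_mem _ (lindemann_mem_pt hinv) h

/-- Classes of equivalent representations agree, so membership transports along moves. [folklore] -/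
theorem lindemann_mem_of_sub_mem_relations {n m : ℕ} {r : KZ.IntegralRep n} {s : KZ.IntegralRep m}
    (h : KZ.of r - KZ.of s ∈ KZ.relations) (hs : KZ.toFormalPeriod (KZ.of s) ∈ Subring.closure
      ({p : KZ.FormalPeriodRing | ∃ (a : ℝ) (ha : IsAlgebraic ℚ a),
          p = KZ.toFormalPeriod (KZ.of (KZ.IntegralRep.unit.constMul a ha))} ∪
        {p : KZ.FormalPeriodRing | ∃ A : KZ.IntegralRep 1, A.domain = {t | t 0 ∈ Set.Ioo (0:ℝ) 1} ∧
          Set.EqOn A.integrand (fun t => 1 / (1 + t 0 ^ 2)) A.domain ∧ p = KZ.toFormalPeriod (KZ.of A)})) :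
    KZ.toFormalPeriod (KZ.of r) ∈ Subring.closure
      ({p : KZ.FormalPeriodRing | ∃ (a : ℝ) (ha : IsAlgebraic ℚ a),
          p = KZ.toFormalPeriod (KZ.of (KZ.IntegralRep.unit.constMul a ha))} ∪
        {p : KZ.FormalPeriodRing | ∃ A : KZ.IntegralRep 1, A.domain = {t | t 0 ∈ Set.Ioo (0:ℝ) 1} ∧
          Set.EqOn A.integrand (fun t => 1 / (1 + t 0 ^ 2)) A.domain ∧ p = KZ.toFormalPeriod (KZ.of A)}) := by
  rwa [KZ.toFormalPeriod_eq_iff.mpr h]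

/-! ## Discs and ellipses -/

/-- **The disc lies in Lindemann's ring**: `⟦[D, c]⟧ = ⟦[pt, 4c]⟧ · ⟦[(0,1), 1/(1+t²)]⟧` for the open
unit disc `D` with a real-algebraic constant integrand `c` (c5's `stub_discClass`, Kontsevich–Zagier's
first example `π = ∬_{x²+y²<1} dx dy`, then the scaling `[σ, 4c·f] = [pt, 4c] × [σ, f]`).
[cite: KontsevichZagier2001, §1.1] -/
theorem lindemann_mem_disc {c : ℝ} (hc : IsAlgebraic ℚ c) (D : KZ.IntegralRep 2)
    (hD : D.domain = {p | p 0 ^ 2 + p 1 ^ 2 < 1}) (hDi : ∀ p ∈ D.domain, D.integrand p = c) :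
    KZ.toFormalPeriod (KZ.of D) ∈ Subring.closure
      ({p : KZ.FormalPeriodRing | ∃ (a : ℝ) (ha : IsAlgebraic ℚ a),
          p = KZ.toFormalPeriod (KZ.of (KZ.IntegralRep.unit.constMul a ha))} ∪
        {p : KZ.FormalPeriodRing | ∃ A : KZ.IntegralRep 1, A.domain = {t | t 0 ∈ Set.Ioo (0:ℝ) 1} ∧
          Set.EqOn A.integrand (fun t => 1 / (1 + t 0 ^ 2)) A.domain ∧ p = KZ.toFormalPeriod (KZ.of A)}) := by
  have h4c : IsAlgebraic ℚ (4 * c) := (isAlgebraic_nat 4).mul hc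
  obtain ⟨L, hLd, hLi⟩ :=
    Summit.KontsevichZagierPeriods.HurwitzMicroSectors.NormalFormPrinciple.PiBox.Dlog.exists_angA
      (a := 0) (b := 1) (d := 4 * c) isAlgebraic_zero isAlgebraic_one h4c
  obtain ⟨A, hAd, hAi⟩ :=
    Summit.KontsevichZagierPeriods.HurwitzMicroSectors.NormalFormPrinciple.PiBox.Dlog.exists_angA
      (a := 0) (b := 1) (d := 1) isAlgebraic_zero isAlgebraic_one isAlgebraic_one
  have hDL : KZ.of D - KZ.of L ∈ KZ.relations := stub_discClass c hc D hD hDi L hLd hLi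
  have hLA : KZ.of L - KZ.of (A.constMul (4 * c) h4c) ∈ KZ.relations :=
    KZ.of_sub_of_mem_relations_of_eqOn (by rw [KZ.IntegralRep.domain_constMul, hAd, hLd])
      fun x _ => by rw [hLi, KZ.IntegralRep.integrand_constMul, hAi]; ring
  refine lindemann_mem_of_sub_mem_relations hDL (lindemann_mem_of_sub_mem_relations hLA ?_)
  rw [KZ.toFormalPeriod_of_constMul]
  exact Subring.mul_mem _ (lindemann_mem_pt h4c) (lindemann_mem_arc A hAd fun x _ => by rw [hAi])

/-- **Ellipses lie in Lindemann's ring**: the image of the unit disc under a real-algebraic affine map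
`x ↦ A x + b` (`det A ≠ 0`) with integrand `1` is ONE change of variables away from `[D, |det A|]`
(c4's `aff_orbit_of_sub_of_mem_changeOfVariablesRel`). [cite: KontsevichZagier2001, §1.2 rule (2)] -/
theorem lindemann_mem_affineDisc (A : Matrix (Fin 2) (Fin 2) ℝ) (b : Fin 2 → ℝ)
    (hA : ∀ j l, IsAlgebraic ℚ (A j l)) (hb : ∀ j, IsAlgebraic ℚ (b j)) (hdet : A.det ≠ 0)
    (r : KZ.IntegralRep 2) (hrd : r.domain = (fun x => A.mulVec x + b) '' {p | p 0 ^ 2 + p 1 ^ 2 < 1})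
    (hri : ∀ x ∈ r.domain, r.integrand x = 1) :
    KZ.toFormalPeriod (KZ.of r) ∈ Subring.closure
      ({p : KZ.FormalPeriodRing | ∃ (a : ℝ) (ha : IsAlgebraic ℚ a),
          p = KZ.toFormalPeriod (KZ.of (KZ.IntegralRep.unit.constMul a ha))} ∪
        {p : KZ.FormalPeriodRing | ∃ A : KZ.IntegralRep 1, A.domain = {t | t 0 ∈ Set.Ioo (0:ℝ) 1} ∧
          Set.EqOn A.integrand (fun t => 1 / (1 + t 0 ^ 2)) A.domain ∧ p = KZ.toFormalPeriod (KZ.of A)}) := by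
  have hdetAlg : IsAlgebraic ℚ |A.det| := by
    have hd : IsAlgebraic ℚ A.det := by
      rw [Matrix.det_fin_two]
      exact ((hA 0 0).mul (hA 1 1)).sub ((hA 0 1).mul (hA 1 0))
    rcases abs_choice A.det with h | h <;> rw [h]
    exacts [hd, hd.neg]
  -- the disc with the constant integrand `|det A|`
  obtain ⟨B, hBd, hBi⟩ := KZ.BallPeeling.exists_ballRep 2 0
  have hBd' : B.domain = {p : Fin 2 → ℝ | p 0 ^ 2 + p 1 ^ 2 < 1} := by
    rw [hBd]
    ext p
    simp [Fin.sum_univ_two]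
  have hDd : (B.constMul |A.det| hdetAlg).domain = {p : Fin 2 → ℝ | p 0 ^ 2 + p 1 ^ 2 < 1} := by
    rw [KZ.IntegralRep.domain_constMul, hBd']
  have hDi : ∀ p ∈ (B.constMul |A.det| hdetAlg).domain, (B.constMul |A.det| hdetAlg).integrand p = |A.det| :=
    fun p _ => by rw [KZ.IntegralRep.integrand_constMul, hBi]; simp
  have hDr : KZ.of (B.constMul |A.det| hdetAlg) - KZ.of r ∈ KZ.changeOfVariablesRel :=
    aff_orbit_of_sub_of_mem_changeOfVariablesRel A b hA hb hdet _ r (by rw [hrd, hDd])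
      fun x hx => by
        rw [hDi x hx, hri _ (by rw [hrd, ← hDd]; exact mem_image_of_mem _ hx), one_mul]
  have h := lindemann_mem_disc hdetAlg _ hDd hDi
  rwa [KZ.toFormalPeriod_eq_iff.mpr (KZ.changeOfVariablesRel_subset_relations hDr)] at h

/-! ## Euler's `β(½,½)` and the even-dimensional balls -/

/-- **`β(½,½)` lies in Lindemann's ring**: `⟦[(0,1), t^{-1/2}(1−t)^{-1/2}]⟧ = ⟦[disc, 1]⟧`
(`KZ.BallPeeling.natCast_add_one_mul_toFormalPeriod_disc` at `e = 0`; Dirichlet's re-association of Beta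
classes is DISCHARGED in the tree: `TerasomaMultiplication.GammaHodgeFromRelators.betaClass_reassoc` with
`GammaHodgeSectorKO.dir_pinned_of_betaClass`). [cite: AndrewsAskeyRoy1999, Thm 1.8.1] -/
theorem lindemann_mem_betaHalf (H : KZ.IntegralRep 1) (hHd : H.domain = {t | t 0 ∈ Set.Ioo (0:ℝ) 1})
    (hHi : Set.EqOn H.integrand
      (fun t => (t 0) ^ (((1 / 2 : ℚ) : ℝ) - 1) * (1 - t 0) ^ (((1 / 2 : ℚ) : ℝ) - 1)) H.domain) :
    KZ.toFormalPeriod (KZ.of H) ∈ Subring.closure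
      ({p : KZ.FormalPeriodRing | ∃ (a : ℝ) (ha : IsAlgebraic ℚ a),
          p = KZ.toFormalPeriod (KZ.of (KZ.IntegralRep.unit.constMul a ha))} ∪
        {p : KZ.FormalPeriodRing | ∃ A : KZ.IntegralRep 1, A.domain = {t | t 0 ∈ Set.Ioo (0:ℝ) 1} ∧
          Set.EqOn A.integrand (fun t => 1 / (1 + t 0 ^ 2)) A.domain ∧ p = KZ.toFormalPeriod (KZ.of A)}) := by
  obtain ⟨D, hDd, hDi⟩ := KZ.BallPeeling.exists_ballRep 2 0
  have h := KZ.BallPeeling.natCast_add_one_mul_toFormalPeriod_disc 0 D H hDd (fun w _ => by rw [hDi]) hHd hHi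
    (Summit.KontsevichZagierPeriods.GammaHodgeSectorKO.dir_pinned_of_betaClass
      Summit.KontsevichZagierPeriods.TerasomaMultiplication.GammaHodgeFromRelators.betaClass_reassoc)
  rw [Nat.cast_zero, zero_add, one_mul] at h
  rw [← h]
  refine lindemann_mem_disc isAlgebraic_one D ?_ fun w hw => ?_
  · rw [hDd]
    ext w
    simp [Fin.sum_univ_two]
  · rw [hDi]
    simp

/-- **The even-dimensional unit balls lie in Lindemann's ring**, every dimension:
`k!·⟦[B_{2k}, 1]⟧ = ⟦β(½,½)⟧^k` (`KZ.BallPeeling.factorial_mul_toFormalPeriod_ball`: peeling two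
coordinates at a time, one change of variables and one Newton–Leibniz move per step), then integer
division by `k!` inside the ring. [cite: KontsevichZagier2001, §1.1] -/
theorem lindemann_mem_ball :
    ∀ (k : ℕ) (b : KZ.IntegralRep (2 * k)), b.domain = {z | ∑ i, (z i) ^ 2 < 1} →
      Set.EqOn b.integrand (fun _ => 1) b.domain →
      KZ.toFormalPeriod (KZ.of b) ∈ Subring.closure
        ({p : KZ.FormalPeriodRing | ∃ (a : ℝ) (ha : IsAlgebraic ℚ a),
            p = KZ.toFormalPeriod (KZ.of (KZ.IntegralRep.unit.constMul a ha))} ∪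
          {p : KZ.FormalPeriodRing | ∃ A : KZ.IntegralRep 1, A.domain = {t | t 0 ∈ Set.Ioo (0:ℝ) 1} ∧
            Set.EqOn A.integrand (fun t => 1 / (1 + t 0 ^ 2)) A.domain ∧ p = KZ.toFormalPeriod (KZ.of A)}) := by
  intro k b hbd hbi
  obtain ⟨H, hHd, hHi⟩ := KZ.exists_betaRep' (1 / 2) (1 / 2) (by norm_num) (by norm_num)
  have h := KZ.BallPeeling.factorial_mul_toFormalPeriod_ball k b H hbd hbi hHd (fun t _ => by rw [hHi])
    (Summit.KontsevichZagierPeriods.GammaHodgeSectorKO.dir_pinned_of_betaClass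
      Summit.KontsevichZagierPeriods.TerasomaMultiplication.GammaHodgeFromRelators.betaClass_reassoc)
  refine lindemann_mem_of_natCast_mul (Nat.factorial_pos k) ?_
  rw [h]
  exact Subring.pow_mem _ (lindemann_mem_betaHalf H hHd fun t _ => by rw [hHi]) k

end Summit.KontsevichZagierPeriods.HyperbolicBloch.OffTetraSectorKernel

end
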